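import Summits.RiemannHypothesis.RiemannHypothesis.Theorems.GroundBartaEvenWinsBeyondArchDeflationEdgeLoc4
import Summits.RiemannHypothesis.RiemannHypothesis.Theorems.GroundBartaEvenWinsBeyondArchDeflationPanelForm
import Summits.RiemannHypothesis.RiemannHypothesis.Theorems.GroundBartaEvenWinsBeyondArchDeflationWindowConst
import Literature.Analysis.ValidatedNumerics.TaylorModelL2Split
import HarnessLib

/-!
# RiemannHypothesis / GroundBarta — rung 4 (`EvenWinsBeyondArch`, stmt-RiemannHypothesis-18807 / 18085):
# the deflated Temple L-side, XIX b′ — window and vector bundles, per-panel bounds `q_j` (kernel-feasible v2)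

Helper file (`--supports stmt-RiemannHypothesis-18807`), RH-free, Mathlib + landed tree files only, no facts.  Prover B,
speedrun unit `sr-gb-rung-b` (gen 4).  The v2 successor of file XIX b: the certificate-facing per-panel theorems on top of
`dt_tmem_residualLocTM` (file XVII b′):
* `dt_WinL` — the WINDOW bundle (prime slots, ρ-panel models `Dρ`, their moments `mu`, G-moments `M0` on panel 0, enclosures of
  `Ψ(2c)`, `log 2 + π/4`, slot weights/lengths, bracket of `log(2h)`) + soundness proofs (data + axioms as one structure);
* `dt_VecL` — the VECTOR bundle of a window polynomial `g`: its even-grid local table `tab` (entry `n + m` ↦ base `2nh`,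
  `|n| ≤ m`), the pole enclosures `Pc`, `Ps`, + proofs;
* `dt_panelQL_bulk`, `dt_panelQL_split`, `dt_panelQL_edge` — `∫_{-h}^{h} R_i(y_j+ρ)² ≤ q_j` for the explicit residual `dt_windowResidual` of
  file XVIII c from one decidable per-panel check plus the bundles (flags: `dt_flagMinus/Plus_sound`, `dt_flag*_Ioo`,
  `dt_switchPlus/Minus_sound` of file XIX a).

References: E. Bombieri, Rend. Mat. Acc. Lincei (9) 11 (2000) Thm 2 [Bombieri2000Weil]; Goerisch–Haunhorst (1985)
[GoerischHaunhorst1985]; K. Makino, M. Berz (2003).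

-/

set_option linter.dupNamespace false

noncomputable section

open MeasureTheory Set Filter intervalIntegral
open scoped Topology BigOperators

namespace Summit.RiemannHypothesis.RiemannHypothesis.Theorems.EvenWinsBeyondArch

open Literature.NumberTheory.LFunctions
open Literature.Analysis.ValidatedNumerics Literature.Analysis.ValidatedNumerics.PolyMP
  Literature.Analysis.ValidatedNumerics.NumericsMP Literature.Analysis.ValidatedNumerics.ExpPoly

/-! ## Bundles -/

/-- **The window bundle (v2)** on the grid `h = c/(2m)`, local degree `Dl`. -/
structure dt_WinL (S : ℕ) (c : ℚ) (m Dl : ℕ) where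
  /-- slot weights and lengths -/
  w1 : ℝ
  L1 : ℝ
  w2 : ℝ
  L2 : ℝ
  w3 : ℝ
  L3 : ℝ
  /-- panel models of `ρ(t_i + u)` (`1 ≤ i < 2m`; entry `0` unused) with reference polynomials -/
  Dρ : List (IPoly × Poly)
  /-- their moments `∫_{-h}^{h} ρ(t_i+u) u^b du`, `b ≤ Dl` -/
  mu : List (List MI)
  /-- G-moments `∫_0^{2h} G t^j dt` -/
  M0 : List MI
  /-- the panel-0 model of `u ↦ G(h + u)` with reference polynomial (edge panel) -/
  DG0 : IPoly × Poly
  /-- data of the `Ψ̃♮`-kernel model (edge panel): `Qinv`, `eK`, reference `pK` -/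
  Qinv : Poly
  eK : ℕ
  pK : Poly
  /-- `∋ Ψ(2c)`, `log 2 + π/4`, slot enclosures, bracket of `log(2h)` -/
  PsiFar : MI
  C0 : MI
  Iw1 : MI
  IL1 : MI
  Iw2 : MI
  IL2 : MI
  Iw3 : MI
  IL3 : MI
  llo : ℚ
  lhi : ℚ
  hDρl : Dρ.length = 2 * m
  hDρ : ∀ i : Fin Dρ.length, 1 ≤ (i : ℕ) →
    TMem S (c / (2 * m)) (fun u ↦ weilArchDensity ((PolyMP.panelCentre (c / (2 * m)) i : ℝ) + u)) (Dρ.get i).1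
  hmu : ∀ i, 1 ≤ i → i < 2 * m → ∀ b, b < Dl + 1 →
    MI.mem S (∫ u in (-((c / (2 * m) : ℚ) : ℝ))..((c / (2 * m) : ℚ) : ℝ),
      weilArchDensity (((PolyMP.panelCentre (c / (2 * m)) i : ℚ) : ℝ) + u) * u ^ b) ((mu.getD i []).getD b default)
  hM0 : ∀ j, j < M0.length →
    MI.mem S (∫ t in (0 : ℝ)..(2 * ((c / (2 * m) : ℚ) : ℝ)), weilArchDensityG t * t ^ j) (M0.getD j default)
  hDG0 : TMem S (c / (2 * m)) (fun u ↦ weilArchDensityG (((PolyMP.panelCentre (c / (2 * m)) 0 : ℚ) : ℝ) + u)) DG0.1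
  hFar : MI.mem S (weilArchTail (2 * (c : ℝ))) PsiFar
  hC0 : MI.mem S (Real.log 2 + Real.pi / 4) C0
  hw1 : MI.mem S w1 Iw1
  hL1 : MI.mem S L1 IL1
  hw2 : MI.mem S w2 Iw2
  hL2 : MI.mem S L2 IL2
  hw3 : MI.mem S w3 Iw3
  hL3 : MI.mem S L3 IL3
  hllo : (llo : ℝ) ≤ Real.log (2 * ((c / (2 * m) : ℚ) : ℝ))
  hlhi : Real.log (2 * ((c / (2 * m) : ℚ) : ℝ)) ≤ lhi
  hlhi0 : lhi ≤ 0

/-- **The vector bundle (v2)** of a window polynomial `g`: even-grid local table, pole enclosures, proofs. -/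
structure dt_VecL (S : ℕ) (c : ℚ) (m Dl : ℕ) (g : Poly) where
  /-- table: entry `(n + m).toNat` is the local table of `g` at `2nh`, `-m ≤ n ≤ m` -/
  tab : List (IPoly × ℤ × ℤ)
  /-- `∋ ∫_{-c}^{c} g cosh(x/2)`, `∋ ∫_{-c}^{c} g sinh(x/2)` -/
  Pc : MI
  Ps : MI
  htab : ∀ n : ℤ, -(m : ℤ) ≤ n → n ≤ m →
    TabOK S (2 * (c / (2 * m))) (fun s ↦ Poly.eval g (2 * (n : ℝ) * ((c / (2 * m) : ℚ) : ℝ) + s))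
      (tab.getD (n + m).toNat default).1 (tab.getD (n + m).toNat default).2.1 (tab.getD (n + m).toNat default).2.2
  htabl : ∀ n : ℤ, -(m : ℤ) ≤ n → n ≤ m → (tab.getD (n + m).toNat default).1.length = Dl + 1
  hPc : MI.mem S (∫ x in (-(c : ℝ))..c, Poly.eval g x * Real.cosh (x / 2)) Pc
  hPs : MI.mem S (∫ x in (-(c : ℝ))..c, Poly.eval g x * Real.sinh (x / 2)) Ps

/-- The table as a function of the grid index. -/
def dt_VecL.tabF {S : ℕ} {c : ℚ} {m Dl : ℕ} {g : Poly} (V : dt_VecL S c m Dl g) : ℤ → IPoly × ℤ × ℤ :=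
  fun n ↦ V.tab.getD (n + m).toNat default

/-- The moments as a function of the panel index. -/
def dt_WinL.muF {S : ℕ} {c : ℚ} {m Dl : ℕ} (W : dt_WinL S c m Dl) : ℕ → List MI := fun i ↦ W.mu.getD i []

/-! ## Flags on open sub-intervals (split panels) -/

/-- `dt_flagMinus_sound` restricted to an open piece `(a, a') ⊆ [-h, h]`. -/
theorem dt_flagMinusL_Ioo {S : ℕ} (hS : 0 < S) {c h y0 : ℚ} {I : MI} {b : Bool} (hb : dt_flagMinus S c h y0 I = some b)
    {L : ℝ} (hL : MI.mem S L I) {a a' : ℝ} (ha : -(h : ℝ) ≤ a) (ha' : a' ≤ h) :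
    ∀ ρ : ℝ, a < ρ → ρ < a' → (b = true ↔ ((y0 : ℝ) + ρ) - L ∈ Icc (-(c : ℝ)) c) :=
  fun _ h1 h2 ↦ dt_flagMinus_sound hS hb hL (abs_le.2 ⟨by linarith, by linarith⟩)

/-- `dt_flagPlus_sound` restricted to an open piece `(a, a') ⊆ [-h, h]`. -/
theorem dt_flagPlusL_Ioo {S : ℕ} (hS : 0 < S) {c h y0 : ℚ} {I : MI} {b : Bool} (hb : dt_flagPlus S c h y0 I = some b)
    {L : ℝ} (hL : MI.mem S L I) {a a' : ℝ} (ha : -(h : ℝ) ≤ a) (ha' : a' ≤ h) :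
    ∀ ρ : ℝ, a < ρ → ρ < a' → (b = true ↔ ((y0 : ℝ) + ρ) + L ∈ Icc (-(c : ℝ)) c) :=
  fun _ h1 h2 ↦ dt_flagPlus_sound hS hb hL (abs_le.2 ⟨by linarith, by linarith⟩)

/-! ## The per-panel bounds -/

section PanelQ

variable {S : ℕ} {c : ℚ} {m Dl k : ℕ}

/-- The decidable part of a bulk panel (v2): `e^{±y_j/2}` enclosures, the six flags, and enough G-moments for `deg g`. -/
def dt_bulkCheckL (S : ℕ) (c : ℚ) (m Dl : ℕ) (W : dt_WinL S c m Dl) (g : Poly) (j Ke ke : ℕ) (f1 f2 f3 : Bool × Bool) :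
    Bool :=
  (MI.expPt S Ke ke (ofRat S (PolyMP.panelCentre (c / (2 * m)) j / 2))).isSome &&
  (MI.expPt S Ke ke (ofRat S (-(PolyMP.panelCentre (c / (2 * m)) j / 2)))).isSome &&
  decide (dt_flagMinus S c (c / (2 * m)) (PolyMP.panelCentre (c / (2 * m)) j) W.IL1 = some f1.1) &&
  decide (dt_flagPlus S c (c / (2 * m)) (PolyMP.panelCentre (c / (2 * m)) j) W.IL1 = some f1.2) &&
  decide (dt_flagMinus S c (c / (2 * m)) (PolyMP.panelCentre (c / (2 * m)) j) W.IL2 = some f2.1) &&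
  decide (dt_flagPlus S c (c / (2 * m)) (PolyMP.panelCentre (c / (2 * m)) j) W.IL2 = some f2.2) &&
  decide (dt_flagMinus S c (c / (2 * m)) (PolyMP.panelCentre (c / (2 * m)) j) W.IL3 = some f3.1) &&
  decide (dt_flagPlus S c (c / (2 * m)) (PolyMP.panelCentre (c / (2 * m)) j) W.IL3 = some f3.2) &&
  decide (g.length ≤ W.M0.length + 1)

/-- The v2 Taylor model of the residual of vector `i` on bulk panel `j` with flags `f`. -/
def dt_panelLTM (S : ℕ) (c : ℚ) (m Dl K Ke ke : ℕ) (W : dt_WinL S c m Dl) (gp : Fin k → Poly) (Mt : ℚ)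
    (Wt : Fin k → Fin k → ℚ) (i : Fin k) (V : dt_VecL S c m Dl (gp i)) (j : ℕ) (f1 f2 f3 : Bool × Bool) : IPoly :=
  dt_residualLocTM S c m j Dl K (gp i) (dt_killPoly gp Mt (Wt i) i) V.tabF W.Dρ W.muF W.M0 W.PsiFar V.Pc V.Ps
    (expRatMI S Ke ke (PolyMP.panelCentre (c / (2 * m)) j / 2)) (expRatMI S Ke ke (-(PolyMP.panelCentre (c / (2 * m)) j / 2)))
    (W.Iw1, W.IL1, f1) (W.Iw2, W.IL2, f2) (W.Iw3, W.IL3, f3)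

/-- **The residual model encloses the explicit residual** (file XVIII c) of vector `i` on bulk panel `j`, given the flag ↔
membership equivalences on the panel (bulk: for all `|ρ| ≤ h`). [cite: Bombieri2000Weil, Thm 2] -/
theorem dt_tmem_panelLTM (hS : 0 < S) (hc : 0 < c) (W : dt_WinL S c m Dl) (hh1 : 2 * (c / (2 * m)) ≤ 1)
    (gp : Fin k → Poly) (Mt : ℚ) (Wt : Fin k → Fin k → ℚ) (i : Fin k) (V : dt_VecL S c m Dl (gp i)) {j : ℕ}
    (hjm : j + 2 ≤ m) {K : ℕ} (hK : 0 < K) {Ke ke : ℕ} (f1 f2 f3 : Bool × Bool)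
    (he1 : (MI.expPt S Ke ke (ofRat S (PolyMP.panelCentre (c / (2 * m)) j / 2))).isSome = true)
    (he2 : (MI.expPt S Ke ke (ofRat S (-(PolyMP.panelCentre (c / (2 * m)) j / 2)))).isSome = true)
    (hlenM : (gp i).length ≤ W.M0.length + 1) :
    TMem S (c / (2 * m)) (fun ρ ↦
      (2 * (∫ x in (-(c : ℝ))..c, Poly.eval (gp i) x * Real.cosh (x / 2)) *
          Real.cosh ((((PolyMP.panelCentre (c / (2 * m)) j : ℚ) : ℝ) + ρ) / 2) -
        2 * (∫ x in (-(c : ℝ))..c, Poly.eval (gp i) x * Real.sinh (x / 2)) *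
          Real.sinh ((((PolyMP.panelCentre (c / (2 * m)) j : ℚ) : ℝ) + ρ) / 2)) +
      (dt_primeSlotFn (gp i) W.w1 W.L1 f1.1 f1.2 (((PolyMP.panelCentre (c / (2 * m)) j : ℚ) : ℝ) + ρ) +
        dt_primeSlotFn (gp i) W.w2 W.L2 f2.1 f2.2 (((PolyMP.panelCentre (c / (2 * m)) j : ℚ) : ℝ) + ρ) +
        dt_primeSlotFn (gp i) W.w3 W.L3 f3.1 f3.2 (((PolyMP.panelCentre (c / (2 * m)) j : ℚ) : ℝ) + ρ)) +
      ((∫ t in Ioc 0 ((c : ℝ) - ((((PolyMP.panelCentre (c / (2 * m)) j : ℚ) : ℝ) + ρ))),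
          weilArchDensityG t * ((2 * Poly.eval (gp i) ((((PolyMP.panelCentre (c / (2 * m)) j : ℚ) : ℝ) + ρ)) -
            Poly.eval (gp i) ((((PolyMP.panelCentre (c / (2 * m)) j : ℚ) : ℝ) + ρ) - t) -
            Poly.eval (gp i) ((((PolyMP.panelCentre (c / (2 * m)) j : ℚ) : ℝ) + ρ) + t)) / t)) +
        ∫ t in Ioc ((c : ℝ) - ((((PolyMP.panelCentre (c / (2 * m)) j : ℚ) : ℝ) + ρ)))
            ((c : ℝ) + ((((PolyMP.panelCentre (c / (2 * m)) j : ℚ) : ℝ) + ρ))),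
          weilArchDensityG t * ((Poly.eval (gp i) ((((PolyMP.panelCentre (c / (2 * m)) j : ℚ) : ℝ) + ρ)) -
            Poly.eval (gp i) ((((PolyMP.panelCentre (c / (2 * m)) j : ℚ) : ℝ) + ρ) - t)) / t)) +
      Poly.eval (gp i) ((((PolyMP.panelCentre (c / (2 * m)) j : ℚ) : ℝ) + ρ)) *
        (weilArchTail ((c : ℝ) - ((((PolyMP.panelCentre (c / (2 * m)) j : ℚ) : ℝ) + ρ))) +
          weilArchTail ((c : ℝ) + ((((PolyMP.panelCentre (c / (2 * m)) j : ℚ) : ℝ) + ρ)))) +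
      Poly.eval (dt_killPoly gp Mt (Wt i) i) ((((PolyMP.panelCentre (c / (2 * m)) j : ℚ) : ℝ) + ρ)))
      (dt_panelLTM S c m Dl K Ke ke W gp Mt Wt i V j f1 f2 f3) := by
  have hh2 : c / (2 * m) ≤ 2 := by linarith
  have hM0' : ∀ j', j' + 1 < (gp i).length →
      MI.mem S (∫ t in (0 : ℝ)..(2 * ((c / (2 * m) : ℚ) : ℝ)), weilArchDensityG t * t ^ j') (W.M0.getD j' default) :=
    fun j' hj' ↦ W.hM0 j' (by omega)
  exact dt_tmem_residualLocTM hS hc hjm hh2 Dl hK (gp i) (dt_killPoly gp Mt (Wt i) i) V.htab V.htabl W.Dρ W.hDρl W.hDρ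
    W.hmu hM0' W.hFar V.hPc V.hPs (dt_mem_expHalf hS he1) (dt_mem_expNegHalf hS he2)
    (W.Iw1, W.IL1, f1) (W.Iw2, W.IL2, f2) (W.Iw3, W.IL3, f3) W.hw1 W.hL1 W.hw2 W.hL2 W.hw3 W.hL3

/-- **Bulk panel (v2).**  For `j + 2 ≤ m`, `2h ≤ 1`, bundles `W`, `V`, and `dt_bulkCheckL` accepting the flags `f`, the explicit
residual of vector `i` satisfies `∫_{-h}^{h} R_i(y_j+ρ)² ≤ sqIntegUpperQ S h (dt_panelLTM …) p` for every reference `p`.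
[cite: Bombieri2000Weil, Thm 2] [cite: GoerischHaunhorst1985, §2] -/
theorem dt_panelQL_bulk (hS : 0 < S) (hc : 0 < c) (W : dt_WinL S c m Dl) (hh1 : 2 * (c / (2 * m)) ≤ 1)
    (gp : Fin k → Poly) (Mt : ℚ) (Wt : Fin k → Fin k → ℚ) (i : Fin k) (V : dt_VecL S c m Dl (gp i)) {j : ℕ}
    (hjm : j + 2 ≤ m) {K : ℕ} (hK : 0 < K) {Ke ke : ℕ} {f1 f2 f3 : Bool × Bool}
    (hchk : dt_bulkCheckL S c m Dl W (gp i) j Ke ke f1 f2 f3 = true)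
    (hRi : IntervalIntegrable (fun ρ ↦
      dt_windowResidual (c : ℝ) gp W.w1 W.L1 W.w2 W.L2 W.w3 W.L3 (Mt : ℝ) (fun a l ↦ (Wt a l : ℝ)) i
        (((PolyMP.panelCentre (c / (2 * m)) j : ℚ) : ℝ) + ρ) ^ 2) volume (-((c / (2 * m) : ℚ) : ℝ)) ((c / (2 * m) : ℚ) : ℝ))
    (p : Poly) :
    ∫ ρ in (-((c / (2 * m) : ℚ) : ℝ))..((c / (2 * m) : ℚ) : ℝ),
        dt_windowResidual (c : ℝ) gp W.w1 W.L1 W.w2 W.L2 W.w3 W.L3 (Mt : ℝ) (fun a l ↦ (Wt a l : ℝ)) i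
          (((PolyMP.panelCentre (c / (2 * m)) j : ℚ) : ℝ) + ρ) ^ 2 ≤
      ((sqIntegUpperQ S (c / (2 * m)) (dt_panelLTM S c m Dl K Ke ke W gp Mt Wt i V j f1 f2 f3) p : ℚ) : ℝ) := by
  unfold dt_bulkCheckL at hchk
  simp only [Bool.and_eq_true, decide_eq_true_eq] at hchk
  obtain ⟨⟨⟨⟨⟨⟨⟨⟨he1, he2⟩, hf1a⟩, hf1b⟩, hf2a⟩, hf2b⟩, hf3a⟩, hf3b⟩, hlenM⟩ := hchk
  have hm : 0 < m := by omega
  have hh0 : 0 ≤ c / (2 * m) := by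
    have : (0 : ℚ) < m := by exact_mod_cast hm
    positivity
  have hTM := dt_tmem_panelLTM hS hc W hh1 gp Mt Wt i V hjm hK f1 f2 f3 he1 he2 hlenM
  have hTM' : TMem S (c / (2 * m)) (fun ρ ↦
      dt_windowResidual (c : ℝ) gp W.w1 W.L1 W.w2 W.L2 W.w3 W.L3 (Mt : ℝ) (fun a l ↦ (Wt a l : ℝ)) i
        (((PolyMP.panelCentre (c / (2 * m)) j : ℚ) : ℝ) + ρ)) (dt_panelLTM S c m Dl K Ke ke W gp Mt Wt i V j f1 f2 f3) := by
    refine tmem_congr_on hTM fun ρ hρ ↦ ?_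
    rw [dt_windowResidual_panelForm c gp W.w1 W.L1 W.w2 W.L2 W.w3 W.L3 Mt Wt i _ ρ,
      dt_primeSlotFn_eq_indicator (gp i) W.w1 W.L1 (dt_flagMinus_sound hS hf1a W.hL1 hρ) (dt_flagPlus_sound hS hf1b W.hL1 hρ),
      dt_primeSlotFn_eq_indicator (gp i) W.w2 W.L2 (dt_flagMinus_sound hS hf2a W.hL2 hρ) (dt_flagPlus_sound hS hf2b W.hL2 hρ),
      dt_primeSlotFn_eq_indicator (gp i) W.w3 W.L3 (dt_flagMinus_sound hS hf3a W.hL3 hρ) (dt_flagPlus_sound hS hf3b W.hL3 hρ)]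
  exact integral_sq_le_sqIntegUpperQ hS hh0 hTM' hRi p

/-- The decidable part of a split panel (v2). -/
def dt_splitCheckL (S : ℕ) (c : ℚ) (m : ℕ) (W0len : ℕ) (g : Poly) (j Ke ke : ℕ) (bm bp : ℚ) : Bool :=
  (MI.expPt S Ke ke (ofRat S (PolyMP.panelCentre (c / (2 * m)) j / 2))).isSome &&
  (MI.expPt S Ke ke (ofRat S (-(PolyMP.panelCentre (c / (2 * m)) j / 2)))).isSome &&
  decide (-(c / (2 * m)) ≤ bm) && decide (bp ≤ c / (2 * m)) && decide (g.length ≤ W0len + 1)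

/-- **Split panel (v2).**  As `dt_panelQL_bulk`, on a panel containing a switch point `β ∈ [b⁻, b⁺]` with flags `f` on
`(-h, β)` and `f'` on `(β, h)`; error terms localised to the two pieces (`sqIntegSubLocQ`). [cite: Bombieri2000Weil, Thm 2]
[cite: GoerischHaunhorst1985, §2] -/
theorem dt_panelQL_split (hS : 0 < S) (hc : 0 < c) (W : dt_WinL S c m Dl) (hh1 : 2 * (c / (2 * m)) ≤ 1)
    (gp : Fin k → Poly) (Mt : ℚ) (Wt : Fin k → Fin k → ℚ) (i : Fin k) (V : dt_VecL S c m Dl (gp i)) {j : ℕ}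
    (hjm : j + 2 ≤ m) {K : ℕ} (hK : 0 < K) {Ke ke : ℕ} (f1 f2 f3 f1' f2' f3' : Bool × Bool) {β : ℝ} {bm bp : ℚ}
    (hchk : dt_splitCheckL S c m W.M0.length (gp i) j Ke ke bm bp = true) (hbmβ : (bm : ℝ) ≤ β) (hβbp : β ≤ bp)
    (hflA : ∀ ρ : ℝ, -((c / (2 * m) : ℚ) : ℝ) < ρ → ρ < β →
      (f1.1 = true ↔ (((PolyMP.panelCentre (c / (2 * m)) j : ℚ) : ℝ) + ρ) - W.L1 ∈ Icc (-(c : ℝ)) c) ∧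
      (f1.2 = true ↔ (((PolyMP.panelCentre (c / (2 * m)) j : ℚ) : ℝ) + ρ) + W.L1 ∈ Icc (-(c : ℝ)) c) ∧
      (f2.1 = true ↔ (((PolyMP.panelCentre (c / (2 * m)) j : ℚ) : ℝ) + ρ) - W.L2 ∈ Icc (-(c : ℝ)) c) ∧
      (f2.2 = true ↔ (((PolyMP.panelCentre (c / (2 * m)) j : ℚ) : ℝ) + ρ) + W.L2 ∈ Icc (-(c : ℝ)) c) ∧
      (f3.1 = true ↔ (((PolyMP.panelCentre (c / (2 * m)) j : ℚ) : ℝ) + ρ) - W.L3 ∈ Icc (-(c : ℝ)) c) ∧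
      (f3.2 = true ↔ (((PolyMP.panelCentre (c / (2 * m)) j : ℚ) : ℝ) + ρ) + W.L3 ∈ Icc (-(c : ℝ)) c))
    (hflB : ∀ ρ : ℝ, β < ρ → ρ < ((c / (2 * m) : ℚ) : ℝ) →
      (f1'.1 = true ↔ (((PolyMP.panelCentre (c / (2 * m)) j : ℚ) : ℝ) + ρ) - W.L1 ∈ Icc (-(c : ℝ)) c) ∧
      (f1'.2 = true ↔ (((PolyMP.panelCentre (c / (2 * m)) j : ℚ) : ℝ) + ρ) + W.L1 ∈ Icc (-(c : ℝ)) c) ∧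
      (f2'.1 = true ↔ (((PolyMP.panelCentre (c / (2 * m)) j : ℚ) : ℝ) + ρ) - W.L2 ∈ Icc (-(c : ℝ)) c) ∧
      (f2'.2 = true ↔ (((PolyMP.panelCentre (c / (2 * m)) j : ℚ) : ℝ) + ρ) + W.L2 ∈ Icc (-(c : ℝ)) c) ∧
      (f3'.1 = true ↔ (((PolyMP.panelCentre (c / (2 * m)) j : ℚ) : ℝ) + ρ) - W.L3 ∈ Icc (-(c : ℝ)) c) ∧
      (f3'.2 = true ↔ (((PolyMP.panelCentre (c / (2 * m)) j : ℚ) : ℝ) + ρ) + W.L3 ∈ Icc (-(c : ℝ)) c))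
    (hRi : IntervalIntegrable (fun ρ ↦
      dt_windowResidual (c : ℝ) gp W.w1 W.L1 W.w2 W.L2 W.w3 W.L3 (Mt : ℝ) (fun a l ↦ (Wt a l : ℝ)) i
        (((PolyMP.panelCentre (c / (2 * m)) j : ℚ) : ℝ) + ρ) ^ 2) volume (-((c / (2 * m) : ℚ) : ℝ)) ((c / (2 * m) : ℚ) : ℝ))
    (pA pB : Poly) :
    ∫ ρ in (-((c / (2 * m) : ℚ) : ℝ))..((c / (2 * m) : ℚ) : ℝ),
        dt_windowResidual (c : ℝ) gp W.w1 W.L1 W.w2 W.L2 W.w3 W.L3 (Mt : ℝ) (fun a l ↦ (Wt a l : ℝ)) i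
          (((PolyMP.panelCentre (c / (2 * m)) j : ℚ) : ℝ) + ρ) ^ 2 ≤
      ((sqIntegSubLocQ S (c / (2 * m)) (dt_panelLTM S c m Dl K Ke ke W gp Mt Wt i V j f1 f2 f3) pA
          (-(c / (2 * m))) bp : ℚ) : ℝ) +
        ((sqIntegSubLocQ S (c / (2 * m)) (dt_panelLTM S c m Dl K Ke ke W gp Mt Wt i V j f1' f2' f3') pB
          bm (c / (2 * m)) : ℚ) : ℝ) := by
  unfold dt_splitCheckL at hchk
  simp only [Bool.and_eq_true, decide_eq_true_eq] at hchk
  obtain ⟨⟨⟨⟨he1, he2⟩, hbm⟩, hbp⟩, hlenM⟩ := hchk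
  have hm : 0 < m := by omega
  have hh0 : 0 ≤ c / (2 * m) := by
    have : (0 : ℚ) < m := by exact_mod_cast hm
    positivity
  have hbp' : ((bp : ℚ) : ℝ) ≤ ((c / (2 * m) : ℚ) : ℝ) := by exact_mod_cast hbp
  have hbm' : -((c / (2 * m) : ℚ) : ℝ) ≤ bm := by exact_mod_cast hbm
  have hA := dt_tmem_panelLTM hS hc W hh1 gp Mt Wt i V hjm hK f1 f2 f3 he1 he2 hlenM
  have hB := dt_tmem_panelLTM hS hc W hh1 gp Mt Wt i V hjm hK f1' f2' f3' he1 he2 hlenM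
  refine integral_sq_split_le_Ioo_loc hS hh0 hA hB pA pB hbm hbmβ hβbp hbp (fun ρ hρ ↦ ?_) (fun ρ hρ ↦ ?_) hRi
  · obtain ⟨h1a, h1b, h2a, h2b, h3a, h3b⟩ := hflA ρ hρ.1 hρ.2
    simp only [dt_windowResidual_panelForm c gp W.w1 W.L1 W.w2 W.L2 W.w3 W.L3 Mt Wt i _ ρ,
      dt_primeSlotFn_eq_indicator (gp i) W.w1 W.L1 h1a h1b, dt_primeSlotFn_eq_indicator (gp i) W.w2 W.L2 h2a h2b,
      dt_primeSlotFn_eq_indicator (gp i) W.w3 W.L3 h3a h3b]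
  · obtain ⟨h1a, h1b, h2a, h2b, h3a, h3b⟩ := hflB ρ hρ.1 hρ.2
    simp only [dt_windowResidual_panelForm c gp W.w1 W.L1 W.w2 W.L2 W.w3 W.L3 Mt Wt i _ ρ,
      dt_primeSlotFn_eq_indicator (gp i) W.w1 W.L1 h1a h1b, dt_primeSlotFn_eq_indicator (gp i) W.w2 W.L2 h2a h2b,
      dt_primeSlotFn_eq_indicator (gp i) W.w3 W.L3 h3a h3b]

end PanelQ
end Summit.RiemannHypothesis.RiemannHypothesis.Theorems.EvenWinsBeyondArch

end
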